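import Mathlib
import HarnessLib
import Summits.ValiantsHypothesis.ValiantsHypothesis.Theorems.BiSetMultilinearCounting

/-!
# Bi-set-multilinear circuits: size, straight-line programs, and non-vacuity

Companion of `BiSetMultilinearCounting.lean` (workshop `decomp-valiant`, lens 6, generation 24; census
cell D3; CALIBRATION only — `VP ≠ VNP` is NOT proved, LADDER-Valiant rung 0). Three corollaries of the
label count `Term.choose_le_card_windowLabels`:

* `Term.choose_le_size` — formula size: a well-formed term computing a polynomial with all permutation
  monomials in its support (column label `univ`, `N = card ι ≥ 2`) has at least `C(N, ⌈N/3⌉)` nodes;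
* `Prog.choose_le_length` — CIRCUIT size: a straight-line program (`Prog` = list of instructions whose
  operands are earlier gates, i.e. a DAG with sharing) one of whose gates unfolds to such a term has at
  least `C(N, ⌈N/3⌉)` instructions, because the distinct labels met in the unfolding of a gate are labels
  of gates (`Prog.windowLabels_subset`); for `per` and `det`: `Prog.perPoly_lower_bound`,
  `Prog.detPoly_lower_bound`;
* `exists_wf_eval_eq_perPoly` — NON-VACUITY: the class is not empty; the expansion
  `∑_π ∏_c x_{(π c, c)}` is a well-formed bi-set-multilinear term with labels `(univ, univ)` computing
  `per` (so the lower bound is a statement about an inhabited circuit class; the matching `O(N 2^N)`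
  Laplace-type upper bound of the census memo is not formalised here).

Reference for the counting idea: [JerrumSnir1982] M. Jerrum, M. Snir, J. ACM 29 (1982) 874–897, §3.
-/

noncomputable section

open MvPolynomial Finset

open scoped Nat

-- lint debt (as in every `…ValiantsHypothesis.Theorems.*` file): the mandated namespace repeats a component.
set_option linter.dupNamespace false

namespace Summit.ValiantsHypothesis.ValiantsHypothesis.Theorems.BiSetMultilinearCounting

open Literature.Computability.AlgebraicComplexity

universe u v

namespace Term

variable {k : Type u} {ι : Type v} [DecidableEq ι]

/-- Number of nodes of a term (formula size). -/
def size : Term k ι → ℕ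
  | input _ _ => 1
  | const _ => 1
  | add t u => size t + size u + 1
  | smul _ t => size t + 1
  | mul t u => size t + size u + 1

/-- Distinct labels are at most the number of nodes. -/
theorem card_labels_le_size : ∀ t : Term k ι, t.labels.card ≤ t.size
  | input _ _ => by simp [labels, size]
  | const _ => by simp [labels, size]
  | add t u => by
      refine (card_insert_le _ _).trans ?_
      have := card_union_le t.labels u.labels
      have ht := card_labels_le_size t; have hu := card_labels_le_size u
      simp only [size]; omega
  | smul _ t => by
      refine (card_insert_le _ _).trans ?_
      have ht := card_labels_le_size t
      simp only [size]; omega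
  | mul t u => by
      refine (card_insert_le _ _).trans ?_
      have := card_union_le t.labels u.labels
      have ht := card_labels_le_size t; have hu := card_labels_le_size u
      simp only [size]; omega

/-- FORMULA SIZE: at least `C(N, ⌈N/3⌉)` nodes. -/
theorem choose_le_size [Fintype ι] [CommRing k] (hN : 2 ≤ Fintype.card ι) (t : Term k ι)
    (ht : t.WF) (hcols : t.cols = univ)
    (hsupp : ∀ π : Equiv.Perm ι, permMonomial π ∈ t.eval.support) :
    (Fintype.card ι).choose (third (Fintype.card ι)) ≤ t.size :=
  (choose_le_card_windowLabels hN t ht hcols hsupp).trans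
    ((card_filter_le _ _).trans t.card_labels_le_size)

end Term

/-! ### Straight-line programs (circuits with sharing) -/

/-- An instruction of a bi-set-multilinear straight-line program; the operands of `add`, `smul`,
`mul` are indices of EARLIER instructions (other indices read as the constant `0`). -/
inductive Instr (k : Type u) (ι : Type v) : Type (max u v)
  | input (r c : ι) : Instr k ι
  | const (a : k) : Instr k ι
  | add (i j : ℕ) : Instr k ι
  | smul (a : k) (i : ℕ) : Instr k ι
  | mul (i j : ℕ) : Instr k ι

/-- A straight-line program: a list of instructions. Its length is the circuit size. -/
abbrev Prog (k : Type u) (ι : Type v) : Type (max u v) := List (Instr k ι)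

namespace Prog

variable {k : Type u} {ι : Type v}

section Build

variable [CommRing k]

/-- Operand fetch from the already unfolded earlier gates (out of range ↦ the constant `0`). -/
def fetch (acc : List (Term k ι)) (j : ℕ) : Term k ι := (acc[j]?).getD (Term.const 0)

/-- A fetched operand is an earlier gate or the constant `0`. -/
theorem fetch_mem_or (acc : List (Term k ι)) (j : ℕ) :
    fetch acc j ∈ acc ∨ fetch acc j = Term.const 0 := by
  unfold fetch
  cases h : acc[j]? with
  | none => exact Or.inr rfl
  | some t => exact Or.inl (by simpa using List.mem_of_getElem? h)

/-- Unfold one instruction, given the unfolded earlier gates. -/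
def build (acc : List (Term k ι)) : Instr k ι → Term k ι
  | Instr.input r c => Term.input r c
  | Instr.const a => Term.const a
  | Instr.add i j => Term.add (fetch acc i) (fetch acc j)
  | Instr.smul a i => Term.smul a (fetch acc i)
  | Instr.mul i j => Term.mul (fetch acc i) (fetch acc j)

/-- Unfold a program gate by gate: `gates acc P` appends to `acc` the unfolded gates of `P`. -/
def gates : List (Term k ι) → Prog k ι → List (Term k ι)
  | acc, [] => acc
  | acc, ins :: P => gates (acc ++ [build acc ins]) P

/-- `gates` adds one term per instruction. -/
theorem length_gates : ∀ (acc : List (Term k ι)) (P : Prog k ι),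
    (gates acc P).length = acc.length + P.length
  | acc, [] => by simp [gates]
  | acc, ins :: P => by rw [gates, length_gates]; simp; omega

end Build

variable [DecidableEq ι]

/-- The labels of the gates unfolded so far, plus the label `(∅, ∅)` of the default operand. -/
def labelSet (acc : List (Term k ι)) : Finset (Finset ι × Finset ι) :=
  insert (∅, ∅) (acc.map fun t => (t.rows, t.cols)).toFinset

/-- `labelSet` grows along the unfolding. -/
theorem labelSet_mono (acc : List (Term k ι)) (t : Term k ι) : labelSet acc ⊆ labelSet (acc ++ [t]) := by
  unfold labelSet
  refine insert_subset_insert _ fun L hL => ?_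
  simp only [List.map_append, List.mem_toFinset, List.mem_append] at hL ⊢
  exact Or.inl hL

/-- The label of an unfolded gate is in `labelSet`. -/
theorem label_mem_labelSet {acc : List (Term k ι)} {t : Term k ι} (ht : t ∈ acc) :
    (t.rows, t.cols) ∈ labelSet acc := by
  unfold labelSet
  exact mem_insert_of_mem (List.mem_toFinset.2 (List.mem_map.2 ⟨t, ht, rfl⟩))

variable [CommRing k]

/-- Operands only meet labels of unfolded gates (or `(∅, ∅)`), if the unfolded gates do. -/
theorem fetch_labels_subset {acc : List (Term k ι)} (h : ∀ t ∈ acc, t.labels ⊆ labelSet acc) (j : ℕ) :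
    (fetch acc j).labels ⊆ labelSet acc := by
  rcases fetch_mem_or acc j with hm | he
  · exact h _ hm
  · rw [he]; unfold labelSet; simp [Term.labels]

/-- Invariant step: every unfolded gate only meets labels of unfolded gates (or `(∅, ∅)`). -/
theorem closed_step {acc : List (Term k ι)} (h : ∀ t ∈ acc, t.labels ⊆ labelSet acc) (ins : Instr k ι) :
    ∀ t ∈ acc ++ [build acc ins], t.labels ⊆ labelSet (acc ++ [build acc ins]) := by
  intro t ht
  rcases List.mem_append.1 ht with ht | ht
  · exact (h t ht).trans (labelSet_mono acc _)
  · simp only [List.mem_singleton] at ht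
    subst ht
    have hself : ((build acc ins).rows, (build acc ins).cols) ∈ labelSet (acc ++ [build acc ins]) :=
      label_mem_labelSet (List.mem_append.2 (Or.inr (List.mem_singleton.2 rfl)))
    have hf : ∀ j, (fetch acc j).labels ⊆ labelSet (acc ++ [build acc ins]) :=
      fun j => (fetch_labels_subset h j).trans (labelSet_mono acc _)
    cases ins with
    | input r c => simpa [build, Term.labels, Term.rows, Term.cols] using hself
    | const a => unfold labelSet; simp [build, Term.labels]
    | add i j =>
        simp only [build, Term.labels, Term.rows, Term.cols] at hself ⊢
        exact insert_subset hself (union_subset (hf i) (hf j))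
    | smul a i =>
        simp only [build, Term.labels, Term.rows, Term.cols] at hself ⊢
        exact insert_subset hself (hf i)
    | mul i j =>
        simp only [build, Term.labels, Term.rows, Term.cols] at hself ⊢
        exact insert_subset hself (union_subset (hf i) (hf j))

/-- The invariant along the whole unfolding. -/
theorem closed_gates : ∀ (acc : List (Term k ι)) (P : Prog k ι),
    (∀ t ∈ acc, t.labels ⊆ labelSet acc) → ∀ t ∈ gates acc P, t.labels ⊆ labelSet (gates acc P)
  | _, [], h => h
  | _, ins :: P, h => closed_gates _ P (closed_step h ins)

/-- The distinct window labels met by a gate of a program are labels of gates of the program. -/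
theorem windowLabels_subset [Fintype ι] (P : Prog k ι) {g : Term k ι} (hg : g ∈ gates [] P) :
    g.windowLabels ⊆ ((gates [] P).map fun t => (t.rows, t.cols)).toFinset := by
  intro L hL
  have hcl := closed_gates ([] : List (Term k ι)) P (by simp)
  have hL' := mem_filter.1 hL
  have hmem := hcl g hg hL'.1
  unfold labelSet at hmem
  rcases mem_insert.1 hmem with h0 | h1
  · exfalso; rw [h0] at hL'; simp at hL'
  · exact h1

/-- CIRCUIT SIZE. A straight-line program one of whose gates unfolds to a well-formed term with column
label `univ` and every permutation monomial in its support has at least `C(N, ⌈N/3⌉)` instructions. -/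
theorem choose_le_length [Fintype ι] (hN : 2 ≤ Fintype.card ι) (P : Prog k ι) {g : Term k ι}
    (hg : g ∈ gates [] P) (hwf : g.WF) (hcols : g.cols = univ)
    (hsupp : ∀ π : Equiv.Perm ι, permMonomial π ∈ g.eval.support) :
    (Fintype.card ι).choose (Term.third (Fintype.card ι)) ≤ P.length :=
  calc (Fintype.card ι).choose (Term.third (Fintype.card ι)) ≤ g.windowLabels.card :=
        Term.choose_le_card_windowLabels hN g hwf hcols hsupp
    _ ≤ ((gates [] P).map fun t => (t.rows, t.cols)).toFinset.card :=
        card_le_card (windowLabels_subset P hg)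
    _ ≤ ((gates [] P).map fun t => (t.rows, t.cols)).length := List.toFinset_card_le _
    _ = P.length := by rw [List.length_map, length_gates]; simp

variable [Nontrivial k] [Fintype ι]

/-- **per, circuits.** Every bi-set-multilinear straight-line program computing `per_ι` at a
well-formed gate with column label `univ` has at least `C(N, ⌈N/3⌉)` instructions (`N = card ι ≥ 2`). -/
theorem perPoly_lower_bound (hN : 2 ≤ Fintype.card ι) (P : Prog k ι) {g : Term k ι}
    (hg : g ∈ gates [] P) (hwf : g.WF) (hcols : g.cols = univ) (heval : g.eval = perPoly ι k) :
    (Fintype.card ι).choose (Term.third (Fintype.card ι)) ≤ P.length :=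
  choose_le_length hN P hg hwf hcols fun π => by
    rw [heval, mem_support_iff, coeff_permMonomial_perPoly]; exact one_ne_zero

/-- **det, circuits.** The same for the determinant (det-blind method). -/
theorem detPoly_lower_bound (hN : 2 ≤ Fintype.card ι) (P : Prog k ι) {g : Term k ι}
    (hg : g ∈ gates [] P) (hwf : g.WF) (hcols : g.cols = univ) (heval : g.eval = detPoly ι k) :
    (Fintype.card ι).choose (Term.third (Fintype.card ι)) ≤ P.length :=
  choose_le_length hN P hg hwf hcols fun π => by
    rw [heval, mem_support_iff, coeff_permMonomial_detPoly]; exact intCast_sign_ne_zero k π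

end Prog

/-! ### Non-vacuity: the permanent has a well-formed bi-set-multilinear term -/

namespace Term

variable {k : Type u} [CommRing k] {ι : Type v} [DecidableEq ι]

/-- The diagonal product `∏_{c ∈ l} x_{(π c, c)}` as a term. -/
def prodTerm (π : Equiv.Perm ι) : List ι → Term k ι
  | [] => const 1
  | c :: l => mul (input (π c) c) (prodTerm π l)

/-- `prodTerm π l` is well formed with labels `(π(l), l)` and computes the diagonal product. -/
theorem prodTerm_spec (π : Equiv.Perm ι) : ∀ l : List ι, l.Nodup →
    (prodTerm (k := k) π l).WF ∧ (prodTerm (k := k) π l).rows = (l.map π).toFinset ∧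
      (prodTerm (k := k) π l).cols = l.toFinset ∧
      (prodTerm (k := k) π l).eval = (l.map fun c => (X (π c, c) : MvPolynomial (ι × ι) k)).prod
  | [], _ => by simp [prodTerm, WF, rows, cols, eval]
  | c :: l, hl => by
      obtain ⟨hc, hl'⟩ := List.nodup_cons.1 hl
      obtain ⟨hwf, hr, hco, hev⟩ := prodTerm_spec π l hl'
      refine ⟨⟨trivial, hwf, ?_, ?_⟩, ?_, ?_, ?_⟩
      · rw [hr]; simp only [rows, disjoint_singleton_left, List.mem_toFinset, List.mem_map, not_exists,
          not_and]
        exact fun c' hc' h => hc (by rwa [← π.injective h])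
      · rw [hco]; simpa [cols] using hc
      · simp only [prodTerm, rows, hr, List.map_cons, List.toFinset_cons, Finset.insert_eq]
      · simp only [prodTerm, cols, hco, List.toFinset_cons, Finset.insert_eq]
      · simp only [prodTerm, eval, hev, List.map_cons, List.prod_cons]

/-- The sum of the diagonal products over a nonempty list of permutations. -/
def sumTerm (l : List ι) : List (Equiv.Perm ι) → Term k ι
  | [] => const 0
  | [π] => prodTerm π l
  | π :: π' :: L => add (prodTerm π l) (sumTerm l (π' :: L))

/-- `sumTerm univ L` is well formed with labels `(univ, univ)` and computes the sum. -/
theorem sumTerm_spec [Fintype ι] : ∀ L : List (Equiv.Perm ι), L ≠ [] →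
    (sumTerm (k := k) univ.toList L).WF ∧ (sumTerm (k := k) univ.toList L).rows = univ ∧
      (sumTerm (k := k) univ.toList L).cols = univ ∧
      (sumTerm (k := k) univ.toList L).eval =
        (L.map fun π => ((univ : Finset ι).toList.map fun c =>
          (X (π c, c) : MvPolynomial (ι × ι) k)).prod).sum
  | [], h => absurd rfl h
  | [π], _ => by
      obtain ⟨hwf, hr, hco, hev⟩ := prodTerm_spec (k := k) π (univ : Finset ι).toList (nodup_toList _)
      refine ⟨by simpa [sumTerm] using hwf, ?_, ?_, by simp [sumTerm, hev]⟩
      · simp only [sumTerm, hr]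
        exact eq_univ_of_forall fun r => List.mem_toFinset.2 (List.mem_map.2 ⟨π.symm r, by simp, by simp⟩)
      · simp [sumTerm, hco]
  | π :: π' :: L, _ => by
      obtain ⟨hwf, hr, hco, hev⟩ := prodTerm_spec (k := k) π (univ : Finset ι).toList (nodup_toList _)
      obtain ⟨hwf', hr', hco', hev'⟩ := sumTerm_spec (π' :: L) (List.cons_ne_nil _ _)
      have hru : (prodTerm (k := k) π (univ : Finset ι).toList).rows = univ := by
        rw [hr]
        exact eq_univ_of_forall fun r => List.mem_toFinset.2 (List.mem_map.2 ⟨π.symm r, by simp, by simp⟩)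
      have hcu : (prodTerm (k := k) π (univ : Finset ι).toList).cols = univ := by simp [hco]
      refine ⟨⟨hwf, hwf', by rw [hr', hru], by rw [hco', hcu]⟩, by simpa [sumTerm, rows] using hru,
        by simpa [sumTerm, cols] using hcu, ?_⟩
      simp [sumTerm, eval, hev, hev']

end Term

/-- NON-VACUITY. The permanent has a well-formed bi-set-multilinear term with labels `(univ, univ)`
(the `N!`-term expansion; so `perPoly_lower_bound` speaks about an inhabited class). -/
theorem exists_wf_eval_eq_perPoly {k : Type u} [CommRing k] {ι : Type v} [Fintype ι] [DecidableEq ι] :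
    ∃ t : Term k ι, t.WF ∧ t.rows = univ ∧ t.cols = univ ∧ t.eval = perPoly ι k := by
  have hne : (univ : Finset (Equiv.Perm ι)).toList ≠ [] := by
    intro h; have := congrArg List.length h; simp at this
  obtain ⟨hwf, hr, hc, hev⟩ := Term.sumTerm_spec (k := k) (univ : Finset (Equiv.Perm ι)).toList hne
  refine ⟨_, hwf, hr, hc, ?_⟩
  rw [hev, Finset.sum_map_toList]
  simp only [Finset.prod_map_toList]
  simp [perPoly, Matrix.permanent, Matrix.mvPolynomialX]

end Summit.ValiantsHypothesis.ValiantsHypothesis.Theorems.BiSetMultilinearCounting
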